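import Summits.AtomisticToContinuum.BoseEinsteinCondensation.Theses.BECChargeConjugationRP

/-!
# Birth skeleton (BC3) for the crux `BECChargeConjugationRP.DialPersistence`
(crux item stmt-AtomisticToContinuum-9046, rank 4, route `route-AtomisticToContinuum-BECChargeConjugationRP`)

Crux (FIXED, by name): `DialPersistence : Prop := ChargedAnchorLRO → RelCornerLRO` — the dial from
the charge-conjugation-symmetric anchor (deep on-site double well, small charge density, uniform
zero-mode intensity `≥ M n⁶`) to the non-relativistic Silver-Blaze corner (mass term `(c²/2)|Φ|²`,
Born pair kernel `b² v^per(b·)`, fixed particle number `N`, `n → ∞`, `c → ∞`, zero-mode intensity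
`≥ κ N n³`).

Skeleton = the route header's own two-layer plan for this node
(`DialPersistence ⇐ MassLeg → ShapeLeg`), typed through ONE waypoint:

* `OnSiteCornerLRO` (waypoint, typed here): uniform condensation of the SAME lattice field family at
  the MASS POINT with an ON-SITE Born-weak quartic — `H_c^{os}(g) = Σ_x [(c²/2)(−Δ_Φx) +
  (c²/2)|Φ_x|² + g|Φ_x|⁴] + Σ_x Σ_i |Φ_(x+eᵢ) − Φ_x|²` in the charge sector `N`: there is a coupling
  window `g ∈ (0, g₀)` and, per `g`, a filling window `N ≤ ν₀ n³` and a `κ > 0` such that for all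
  large even `n`, every `N` in the window and all `c ≥ c₀(g,n,N)`, every `δ`-near-minimiser has
  `∫ |Σ_x Φ_x|² |Ψ|² ≥ κ N n³` (order parameter now carried by the charge: `κ N n³ = κ ν n⁶`).
  Quantifier prefix deliberately that of `RelCornerLRO` (κ before `n, N, c`; `c₀` innermost), so the
  second leg compares like with like.
* `stub_massLeg  : ChargedAnchorLRO → OnSiteCornerLRO` — MASS LEG (+ NR uniformity): deform the
  double well `lam(|Φ|² − w)²` to `(c²/2)|Φ|² + g|Φ|⁴` at fixed sector density, the charge density
  taking over the condensate from the well depth; the output constant must be uniform in `c ≥ c₀`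
  (large pair gap `2c²`: the effective model is the lattice Bose gas with hopping 1, on-site `U ∼ g`).
* `stub_shapeLeg : OnSiteCornerLRO → RelCornerLRO` — INTERACTION-SHAPE LEG: smear the on-site
  quartic into the kernel `b² v^per(b·)` of lattice range `R n / L → ∞` and height `→ 0` (Born
  sense; lattice scattering length `a n / L → ∞` while the filling `N/n³ → 0` at fixed gas parameter
  `ρ a³`), at fixed `N` along `b = L/n → 0`.
* `DialPersistence_of : Goal.stub_massLeg → Goal.stub_shapeLeg → DialPersistence` — composition
  (the crux is itself an implication, so every skeleton of it is a factorisation through waypoints;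
  the content of this one is the TYPED waypoint, at which the header's mass leg and shape leg meet).

Honest sizes: both stubs are open-problem-sized (the grounder's verdict on the crux: "no engine in
print"); neither is bookkeeping. Disproof used: none exists for this crux (`ledger crux ls`: no
workfiles, no `Negative/` lemmas) — nothing to honour yet.

`lean check`: sorries ONLY in `stub_massLeg`, `stub_shapeLeg`.
-/

namespace Summit.AtomisticToContinuum.BoseEinsteinCondensation.Cruxes.DialPersistence.Birth

open scoped BigOperators Topology Classical MeasureTheory ENNReal NNReal ComplexConjugate
open Filter Set Function MeasureTheory
open Summit.AtomisticToContinuum.BoseEinsteinCondensation.Theses.BECChargeConjugationRP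

/-- WAYPOINT of the dial: uniform condensation at the MASS POINT with an ON-SITE Born-weak quartic.
Same wave-function model as `RelCornerLRO` (one complex coordinate per site of `(ℤ/nℤ)³`, Lebesgue
measure, `C¹` normalised trial states of charge `N`), Hamiltonian
`H = Σ_x [(c²/2)(−Δ_Φx) + (c²/2)|Φ_x|² + g |Φ_x|⁴] + Σ_x Σ_i |Φ_(x+eᵢ) − Φ_x|²`:
`∃ g₀ > 0, ∀ g ∈ (0,g₀), ∃ ν₀ > 0, ∃ κ > 0, ∃ n₀, ∀ even n ≥ n₀, ∀ N ≤ ν₀ n³, ∃ c₀, ∀ c ≥ c₀`,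
every `δ`-near-minimiser `Ψ` of the sector-`N` energy has `∫ |Σ_x Φ_x|² |Ψ|² ≥ κ N n³`. -/
def OnSiteCornerLRO : Prop :=
  ∃ g₀ : ℝ, 0 < g₀ ∧ ∀ g : ℝ, 0 < g → g < g₀ → ∃ ν₀ : ℝ, 0 < ν₀ ∧ ∃ κ : ℝ, 0 < κ ∧ ∃ n₀ : ℕ,
    ∀ (n : ℕ) [NeZero n], Even n → n₀ ≤ n → ∀ N : ℕ, (N : ℝ) ≤ ν₀ * (n : ℝ) ^ 3 → ∃ c₀ : ℝ,
    ∀ c : ℝ, c₀ ≤ c →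
    let U : ((Fin 3 → ZMod n) → ℂ) → ENNReal := fun Φ => ENNReal.ofReal (∑ x, (c ^ 2 / 2 * ‖Φ x‖ ^ 2
      + ∑ i : Fin 3, ‖Φ (x + Pi.single i 1) - Φ x‖ ^ 2 + g * ‖Φ x‖ ^ 4))
    let E : (((Fin 3 → ZMod n) → ℂ) → ℂ) → ENNReal := fun Ψ => ∫⁻ Φ, ENNReal.ofReal (c ^ 2 / 2) *
      (∑ x, ((‖fderiv ℝ Ψ Φ (Pi.single x 1)‖₊ : ENNReal) ^ 2
        + (‖fderiv ℝ Ψ Φ (Pi.single x Complex.I)‖₊ : ENNReal) ^ 2)) + U Φ * (‖Ψ Φ‖₊ : ENNReal) ^ 2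
    let T : (((Fin 3 → ZMod n) → ℂ) → ℂ) → Prop := fun Ψ => ContDiff ℝ 1 Ψ ∧
      ∫⁻ Φ, (‖Ψ Φ‖₊ : ENNReal) ^ 2 = 1 ∧ ∀ (θ : ℝ) (Φ : (Fin 3 → ZMod n) → ℂ),
        Ψ (fun x => Complex.exp (θ * Complex.I) * Φ x) = Complex.exp (N * θ * Complex.I) * Ψ Φ
    ∃ δ : ENNReal, 0 < δ ∧ ∀ Ψ, T Ψ → E Ψ ≤ (⨅ (Ψ' : ((Fin 3 → ZMod n) → ℂ) → ℂ) (_ : T Ψ'), E Ψ') + δ →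
      ENNReal.ofReal (κ * N * (n : ℝ) ^ 3) ≤ ∫⁻ Φ, (‖∑ x, Φ x‖₊ : ENNReal) ^ 2 * (‖Ψ Φ‖₊ : ENNReal) ^ 2

/-- MASS LEG of the dial (route header, two-layer plan): the charged anchor's uniform order survives
the deformation of the on-site double well `lam(|Φ|² − w)²` into the mass term plus a Born-weak
on-site quartic, at fixed (small) sector density, with constants uniform in `c ≥ c₀`. -/
def MassLeg : Prop := ChargedAnchorLRO → OnSiteCornerLRO

/-- INTERACTION-SHAPE LEG of the dial (route header, two-layer plan): from the on-site quartic to the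
Born pair kernel `b² v^per(b·)` of diverging lattice range, at fixed particle number along
`b = L/n → 0` — the lattice-regularised dilute corner `RelCornerLRO`. -/
def ShapeLeg : Prop := OnSiteCornerLRO → RelCornerLRO

namespace Goal
/-- registered obligation: the mass leg. -/
abbrev stub_massLeg : Prop := MassLeg
/-- registered obligation: the interaction-shape leg. -/
abbrev stub_shapeLeg : Prop := ShapeLeg
end Goal

/-- STUB (mass leg + non-relativistic uniformity; open-problem-sized: the first step off the
reflection-positive point, `rp_oddCharge_eq_zero` forbids RP states in every sector `Q ≠ 0`). -/
theorem stub_massLeg : Goal.stub_massLeg := by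
  sorry

/-- STUB (interaction-shape leg; open-problem-sized: on-site → long-range Born kernel while the
filling goes to zero at fixed gas parameter). -/
theorem stub_shapeLeg : Goal.stub_shapeLeg := by
  sorry

/-- COMPOSITION (kernel-checked, sorry-free): the two legs give the crux BY NAME. -/
theorem DialPersistence_of (h₁ : Goal.stub_massLeg) (h₂ : Goal.stub_shapeLeg) :
    Summit.AtomisticToContinuum.BoseEinsteinCondensation.Theses.BECChargeConjugationRP.DialPersistence :=
  fun hA => h₂ (h₁ hA)

/-- The crux from the two open stubs (displayed modulo the two sorries). -/
theorem dialPersistence_proof_skeleton :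
    Summit.AtomisticToContinuum.BoseEinsteinCondensation.Theses.BECChargeConjugationRP.DialPersistence :=
  DialPersistence_of stub_massLeg stub_shapeLeg

end Summit.AtomisticToContinuum.BoseEinsteinCondensation.Cruxes.DialPersistence.Birth
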